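import Literature.AlgebraicGeometry.Resolution.MacaulayficationKawasakiStepsOne
import HarnessLib

/-!
# Kawasaki's interwoven induction, Step 5, first half (Kawasaki 2000, proof of Thm. 3.1)

Topic: `Literature/AlgebraicGeometry/Resolution`. Brick of the proof of the named facts
`KawasakiMacaulayfication` / `CesnaviciusMacaulayfication`; sequel of
`MacaulayficationKawasakiStepsOne.lean`. Step 5 of the printed proof of Kawasaki 2000, Thm. 3.1
(pp. 2524–2526): **if `j > i`, then `(A_ij)` comes from `(A_{i+1,j})` and `(C_{i+1,j})`.** This
file does its first half:

* bookkeeping used by Steps 5–9 (`tailIdeal_pow_le_span_sup`, `seg_eq_cons`,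
  `IsPStandard.isSecantSequence_drop_of_le`, `….isSecantSequence_drop_succ_snoc`,
  `….colonBy_seg_mul_eq`, `….mem_sup_seg_of_smul_mem`);
* the auxiliary inclusion **(3.1.6)** (`IsPStandard.kawasaki316`):
  `(y, xᵢ,…,x_{l-1})M : x_l ∩ [(y)M + q_{i+1}^{n_{i+1}}⋯qⱼ^{nⱼ}M] ⊆ (y)M + (xᵢ,…,x_{l-1})q_{i+1}^{n_{i+1}-1}⋯qⱼ^{nⱼ}M`;
* `(3.1.1)` **in the case `k = i`** (`IsPStandard.kawasakiA31_left`), by induction on `nᵢ` and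
  descending induction on `l`, as printed.

Everything is proved; no named fact is introduced.

## References

* [Kawasaki2000] T. Kawasaki, *On Macaulayfication of Noetherian schemes*, Trans. AMS 352 (2000)
  2517–2552, proof of Thm. 3.1, Step 5 (first half, pp. 2524–2525).
-/

namespace Literature.AlgebraicGeometry.Resolution

open Ideal Submodule Module IsLocalRing
open scoped Pointwise

universe u v

section Ring

variable {R : Type u} [CommRing R] {xs : List R}

/-- `qᵢ₊₁^a ⊆ (xᵢ₊₁) + qᵢ₊₂^a` ("since `(xᵢ) + qᵢ^{nᵢ} = (xᵢ) + q_{i+1}^{nᵢ}`", Step 5).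
[cite: Kawasaki2000, Thm. 3.1, Step 5] -/
theorem tailIdeal_pow_le_span_sup {i : ℕ} (hi : i < xs.length) (a : ℕ) :
    tailIdeal xs i ^ a ≤ span {xs[i]} ⊔ tailIdeal xs (i + 1) ^ a := by
  induction a with
  | zero => rw [pow_zero, pow_zero]; exact le_sup_right
  | succ a ih =>
    rw [pow_succ, pow_succ]
    refine (Ideal.mul_mono ih (tailIdeal_eq_span_sup hi).le).trans ?_
    rw [Ideal.sup_mul, Ideal.mul_sup, Ideal.mul_sup]
    exact sup_le (sup_le (Ideal.mul_le_right.trans le_sup_left) (Ideal.mul_le_right.trans le_sup_left))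
      (sup_le (Ideal.mul_le_left.trans le_sup_left) le_sup_right)

end Ring

section Lists

variable {α : Type*} {xs : List α}

/-- `seg xs i l = xs[i] :: seg xs (i+1) l` for `i < l`. [folklore] -/
theorem seg_eq_cons {i l : ℕ} (hil : i < l) (hi : i < xs.length) :
    seg xs i l = xs[i] :: seg xs (i + 1) l := by
  obtain ⟨t, ht⟩ : ∃ t, l - i = t + 1 := ⟨l - i - 1, by omega⟩
  have ht' : l - (i + 1) = t := by omega
  rw [seg, seg, List.drop_eq_getElem_cons hi, ht, List.take_succ_cons, ht']

/-- `xs[l] ∈ seg xs k l'` for `k ≤ l < l'`. [folklore] -/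
theorem getElem_mem_seg {k l l' : ℕ} (hkl : k ≤ l) (hll : l < l') (hl' : l' ≤ xs.length) :
    xs[l]'(by omega) ∈ seg xs k l' := by
  rw [seg, List.mem_iff_getElem]
  refine ⟨l - k, ?_, ?_⟩
  · rw [List.length_take, List.length_drop]; omega
  · simp only [List.getElem_take, List.getElem_drop, Nat.add_sub_cancel' hkl]

end Lists

variable {R : Type u} [CommRing R] [IsLocalRing R]
variable {M : Type v} [AddCommGroup M] [Module R M]

namespace IsPStandard

variable {xs : List R}

/-- The entries of `xs.drop i ++ ys` lie in `𝔪` when those of `ys` do. [folklore] -/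
theorem mem_maximalIdeal_drop_append (hx : IsPStandard M xs) (i : ℕ) {ys : List R}
    (hym : ∀ y ∈ ys, y ∈ maximalIdeal R) : ∀ r ∈ xs.drop i ++ ys, r ∈ maximalIdeal R :=
  fun r hr => by
    rcases List.mem_append.mp hr with hr | hr
    · exact hx.mem_maximalIdeal r (List.mem_of_mem_drop hr)
    · exact hym r hr

variable [IsNoetherianRing R] [Module.Finite R M]

/-- A subsystem of parameters of `M/qᵢ₊₁M` is one of `M/q_{i'+1}M` for `i ≤ i'` (sublist).
[cite: Kawasaki2000, Thm. 3.1, Step 5] -/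
theorem isSecantSequence_drop_of_le (hx : IsPStandard M xs) {i i' : ℕ} (hii : i ≤ i')
    {ys : List R} (hys : IsSecantSequence M (xs.drop i ++ ys)) (hym : ∀ y ∈ ys, y ∈ maximalIdeal R) :
    IsSecantSequence M (xs.drop i' ++ ys) :=
  hys.sublist ((List.drop_sublist_drop_left xs hii).append (List.Sublist.refl ys))
    (hx.mem_maximalIdeal_drop_append i hym)

/-- **"`y₁,…,y_u, xᵢ` is a subsystem of parameters for `M/q_{i+1}M`"** (Step 5): if `ys` is one
of `M/qᵢ₊₁M` then `ys ++ [xs[i]]` is one of `M/qᵢ₊₂M` (permutation).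
[cite: Kawasaki2000, Thm. 3.1, Step 5] -/
theorem isSecantSequence_drop_succ_snoc (hx : IsPStandard M xs) {i : ℕ} (hi : i < xs.length)
    {ys : List R} (hys : IsSecantSequence M (xs.drop i ++ ys)) (hym : ∀ y ∈ ys, y ∈ maximalIdeal R) :
    IsSecantSequence M (xs.drop (i + 1) ++ (ys ++ [xs[i]])) := by
  classical
  refine hys.of_perm ?_ (hx.mem_maximalIdeal_drop_append i hym)
  rw [List.drop_eq_getElem_cons hi]
  exact List.perm_iff_count.mpr fun r => by
    simp only [List.count_append, List.count_cons, List.count_nil]; omega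

/-- **`xᵢ₊₁,…,x_d` is a `d`-sequence on `M/(y)M`, segment form** (Cor. 2.10): for a subsystem of
parameters `ys` of `M/qᵢ₊₁M` and `i ≤ l ≤ l' < d`,
`(y, xᵢ₊₁,…,x_l)M : x_{l+1}x_{l'+1} = (y, xᵢ₊₁,…,x_l)M : x_{l'+1}` (`0`-based: `seg xs i l`,
`xs[l]`, `xs[l']`). [cite: Kawasaki2000, Cor. 2.10] -/
theorem colonBy_seg_mul_eq (hx : IsPStandard M xs) {i : ℕ} {ys : List R}
    (hys : IsSecantSequence M (xs.drop i ++ ys)) (hym : ∀ y ∈ ys, y ∈ maximalIdeal R)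
    {l l' : ℕ} (hil : i ≤ l) (hll : l ≤ l') (hl' : l' < xs.length) :
    colonBy (ofList (ys ++ seg xs i l) • ⊤ : Submodule R M) (xs[l] * xs[l']) =
      colonBy (ofList (ys ++ seg xs i l) • ⊤ : Submodule R M) xs[l'] := by
  have hK : IsKDSequence (ofList ys • ⊤ : Submodule R M) (xs.drop i) :=
    hx.isKDSequence (X₀ := xs.take i) (D := xs.drop i) (List.take_append_drop i xs).symm hys hym
  have h1 : (xs.drop i)[l - i]'(by rw [List.length_drop]; omega) = xs[l] := by
    simp only [List.getElem_drop, Nat.add_sub_cancel' hil]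
  have h2 : (xs.drop i)[l' - i]'(by rw [List.length_drop]; omega) = xs[l'] := by
    simp only [List.getElem_drop, Nat.add_sub_cancel' (hil.trans hll)]
  have key := hK.colonBy_mul_eq (i := l - i) (j := l' - i) (by omega)
    (by rw [List.length_drop]; omega)
  rw [h1, h2] at key
  rw [ofList_append_smul]
  exact key

/-- **Lemma 2.2 on `M/(y)M`, segment form**: for a subsystem of parameters `ys` of `M/qᵢ₊₁M` and
`i ≤ l < d`, if `m ∈ (y)M + qᵢ₊₁M` and `x_{l+1}m ∈ (y, xᵢ₊₁,…,x_l)M` then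
`m ∈ (y, xᵢ₊₁,…,x_l)M` (in particular, `l = i`: `(y)M : xᵢ₊₁ ∩ (y, xᵢ₊₁,…,x_d)M = (y)M`,
"because of Lemma 2.2"). [cite: Kawasaki2000, Lemma 2.2] -/
theorem mem_sup_seg_of_smul_mem (hx : IsPStandard M xs) {i : ℕ} {ys : List R}
    (hys : IsSecantSequence M (xs.drop i ++ ys)) (hym : ∀ y ∈ ys, y ∈ maximalIdeal R)
    {l : ℕ} (hil : i ≤ l) (hl : l < xs.length) {m : M}
    (hm : m ∈ (ofList ys • ⊤ ⊔ tailIdeal xs i • ⊤ : Submodule R M))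
    (hxm : xs[l] • m ∈ (ofList (ys ++ seg xs i l) • ⊤ : Submodule R M)) :
    m ∈ (ofList (ys ++ seg xs i l) • ⊤ : Submodule R M) := by
  have hK : IsKDSequence (ofList ys • ⊤ : Submodule R M) (xs.drop i) :=
    hx.isKDSequence (X₀ := xs.take i) (D := xs.drop i) (List.take_append_drop i xs).symm hys hym
  have h1 : (xs.drop i)[l - i]'(by rw [List.length_drop]; omega) = xs[l] := by
    simp only [List.getElem_drop, Nat.add_sub_cancel' hil]
  rw [ofList_append_smul] at hxm ⊢
  have key := hK.mem_of_smul_mem (i := l - i) (by rw [List.length_drop]; omega) hm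
  rw [h1] at key
  exact key hxm

/-- **(3.1.6)** (Kawasaki 2000, proof of Thm. 3.1, Step 5): given `(A_{i+1,j})` and
`(C_{i+1,j})`, for every subsystem of parameters `y` of `M/qᵢM` and `i ≤ l ≤ d+1` (`1`-based),
`(y, xᵢ,…,x_{l-1})M : x_l ∩ [(y)M + q_{i+1}^{n_{i+1}}⋯qⱼ^{nⱼ}M] ⊆ (y)M + (xᵢ,…,x_{l-1})q_{i+1}^{n_{i+1}-1}⋯qⱼ^{nⱼ}M`.
Proof as printed: apply `(A_{i+1,j})` to the subsystem of parameters `y, xᵢ` of `M/q_{i+1}M`,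
write `a = xᵢb + c`, and bound `b ∈ [(y)M + q₊M] : xᵢ` by `(C_{i+1,j})`; for `l = i` use
Lemma 2.2. [cite: Kawasaki2000, Thm. 3.1, Step 5 (3.1.6)] -/
theorem kawasaki316 (hx : IsPStandard M xs) {i j : ℕ} (hij : i + 1 ≤ j) (hj : j < xs.length)
    (hA : Kawasaki.A31 M xs (i + 1) j) (hC : Kawasaki.C31 M xs (i + 1) j)
    {n : ℕ → ℕ} (hn : Kawasaki.PosOn n (i + 1) j) {ys : List R}
    (hys : IsSecantSequence M (xs.drop i ++ ys)) (hym : ∀ y ∈ ys, y ∈ maximalIdeal R)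
    {l : ℕ} (hil : i ≤ l) (hl : l ≤ xs.length) :
    colonBy (ofList (ys ++ seg xs i l) • ⊤ : Submodule R M) (xs.getD l 1) ⊓
        (ofList ys • ⊤ ⊔ prodPow xs n (i + 1) j • ⊤) ≤
      ofList ys • ⊤ ⊔ ofList (seg xs i l) •
        (prodPow xs (Function.update n (i + 1) (n (i + 1) - 1)) (i + 1) j • ⊤) := by
  have hi : i < xs.length := by omega
  have hiIcc : i + 1 ∈ Finset.Icc (i + 1) j := Finset.mem_Icc.mpr ⟨le_rfl, hij⟩
  have hni : 0 < n (i + 1) := hn _ hiIcc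
  intro a ha
  obtain ⟨ha1, ha2⟩ := Submodule.mem_inf.mp ha
  rcases hil.eq_or_lt with rfl | hil
  · -- `l = i`: `(y)M : xᵢ ∩ (y, xᵢ,…,x_d)M = (y)M` by Lemma 2.2
    rw [seg_self, ofList_nil, Submodule.bot_smul, sup_bot_eq]
    rw [seg_self, List.append_nil, mem_colonBy, getD_eq_getElem hi] at ha1
    have := hx.mem_sup_seg_of_smul_mem hys hym le_rfl hi
      (mem_sup_of_le_right (Submodule.smul_mono_left ((prodPow_le_tailIdeal hiIcc hni).trans
        (tailIdeal_antitone xs (Nat.le_succ i)))) ha2)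
      (by rwa [seg_self, List.append_nil])
    rwa [seg_self, List.append_nil] at this
  · -- `l > i`: apply `(A_{i+1,j})` to the subsystem of parameters `y, xᵢ` of `M/q_{i+1}M`
    have hys' := hx.isSecantSequence_drop_succ_snoc hi hys hym
    have hym' : ∀ y ∈ ys ++ [xs[i]], y ∈ maximalIdeal R := fun y hy => by
      rcases List.mem_append.mp hy with hy | hy
      · exact hym y hy
      · rw [List.mem_singleton] at hy; rw [hy]
        exact hx.mem_maximalIdeal _ (List.getElem_mem hi)
    have hA' := hA n hn (ys ++ [xs[i]]) hys' hym' (i + 1) l le_rfl hij hil hl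
    have e1 : ys ++ [xs[i]] ++ seg xs (i + 1) l = ys ++ seg xs i l := by
      rw [List.append_assoc, List.singleton_append, ← seg_eq_cons hil hi]
    rw [e1] at hA'
    have ha' : a ∈ ofList (ys ++ [xs[i]]) • ⊤ ⊔ ofList (seg xs (i + 1) l) •
        (prodPow xs (Function.update n (i + 1) (n (i + 1) - 1)) (i + 1) j • (⊤ : Submodule R M)) := by
      rw [← hA']
      refine Submodule.mem_inf.mpr ⟨ha1, ?_⟩
      exact mem_sup_of_le_left (Submodule.smul_mono_left (ofList_mono_of_subset fun r hr =>
        List.mem_append_left _ hr)) ha2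
    -- `a = c + xᵢ b` with `c ∈ (y)M + (x_{i+1},…,x_{l-1})q₊'M`
    rw [ofList_append_smul, ofList_singleton, sup_right_comm] at ha'
    obtain ⟨c, hc, t, ht, e2⟩ := Submodule.mem_sup.mp ha'
    obtain ⟨b, -, rfl⟩ := mem_span_singleton_smul_iff.mp ht
    -- `b ∈ [(y)M + q₊M] : xᵢ ⊆ (y)M : xᵢ + q₊'M` by `(C_{i+1,j})`
    have hseg : ofList (seg xs (i + 1) l) •
        (prodPow xs (Function.update n (i + 1) (n (i + 1) - 1)) (i + 1) j • (⊤ : Submodule R M)) ≤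
          prodPow xs n (i + 1) j • ⊤ :=
      smul_prodPow_update_smul_le (ofList_seg_le_tailIdeal xs (i + 1) l) hiIcc hni ⊤
    have hb : b ∈ colonBy (ofList ys • ⊤ ⊔ prodPow xs n (i + 1) j • ⊤ : Submodule R M) xs[i] := by
      rw [mem_colonBy]
      have e : xs[i] • b = a - c := by rw [← e2]; abel
      rw [e]
      exact Submodule.sub_mem _ ha2 (mem_sup_of_le_right hseg hc)
    have hb' := hC n hn ys xs[i] hys' hym' hb
    obtain ⟨b₁, hb₁, b₂, hb₂, e3⟩ := Submodule.mem_sup.mp hb'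
    rw [mem_colonBy] at hb₁
    -- assemble `a = c + xᵢb₁ + xᵢb₂`
    have e4 : a = c + xs[i] • b₁ + xs[i] • b₂ := by rw [← e2, ← e3, smul_add, add_assoc]
    rw [e4]
    refine Submodule.add_mem _ (Submodule.add_mem _ ?_ (Submodule.mem_sup_left hb₁)) ?_
    · refine mem_sup_of_le_right (Submodule.smul_mono_left (ofList_mono_of_subset fun r hr => ?_)) hc
      rw [seg_eq_cons hil hi]
      exact List.mem_cons_of_mem _ hr
    · refine Submodule.mem_sup_right (Submodule.smul_mem_smul (Ideal.subset_span ?_) hb₂)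
      rw [seg_eq_cons hil hi]
      exact List.mem_cons_self

/-- **Descending induction on `l` for (3.1.1), `k = i`** (Kawasaki 2000, proof of Thm. 3.1,
Step 5, "we work by induction on `l`"): the inclusion `⊆` of (3.1.1) at `k = i` for all `l`,
given a rule `place` that puts `x_la'` into the right-hand side whenever
`a' ∈ (y,xᵢ,…,x_{l-1})M : x_l ∩ q^{n'}M` (supplied by (3.1.6) if `nᵢ = 1` and by the statement
for `nᵢ - 1` otherwise). With `a` on the left at `l < d`: `a ∈ (y,xᵢ,…,x_l)M : x_{l+1} ∩ […]`
(`d`-sequence), so `a = b + x_la'` by the statement at `l + 1`, and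
`a' ∈ (y,xᵢ,…,x_{l-1})M : x_l² = … : x_l`. [cite: Kawasaki2000, Thm. 3.1, Step 5] -/
theorem kawasakiA31_left_desc (hx : IsPStandard M xs) {i j : ℕ} (hij : i + 1 ≤ j)
    (hj : j < xs.length) {n : ℕ → ℕ} (hn : Kawasaki.PosOn n i j) {ys : List R}
    (hys : IsSecantSequence M (xs.drop i ++ ys)) (hym : ∀ y ∈ ys, y ∈ maximalIdeal R)
    (place : ∀ l, i < l → ∀ hl : l < xs.length, ∀ a' : M,
      a' ∈ colonBy (ofList (ys ++ seg xs i l) • ⊤ : Submodule R M) xs[l] →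
      a' ∈ (prodPow xs (Function.update n i (n i - 1)) i j • ⊤ : Submodule R M) →
        xs[l] • a' ∈ ofList ys • ⊤ ⊔ ofList (seg xs i l) •
          (prodPow xs (Function.update n i (n i - 1)) i j • (⊤ : Submodule R M)))
    {l : ℕ} (hil : i ≤ l) (hl : l ≤ xs.length) :
    colonBy (ofList (ys ++ seg xs i l) • ⊤ : Submodule R M) (xs.getD l 1) ⊓
        (ofList ys • ⊤ ⊔ prodPow xs n i j • ⊤) ≤
      ofList ys • ⊤ ⊔ ofList (seg xs i l) • (prodPow xs (Function.update n i (n i - 1)) i j • ⊤) := by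
  have hi : i < xs.length := by omega
  have hiIcc : i ∈ Finset.Icc i j := Finset.mem_Icc.mpr ⟨le_rfl, by omega⟩
  -- descending induction on `l`, measured by `c` with `xs.length ≤ l + c`
  suffices desc : ∀ (c l : ℕ), xs.length ≤ l + c → i ≤ l → l ≤ xs.length →
      colonBy (ofList (ys ++ seg xs i l) • ⊤ : Submodule R M) (xs.getD l 1) ⊓
          (ofList ys • ⊤ ⊔ prodPow xs n i j • ⊤) ≤
        ofList ys • ⊤ ⊔ ofList (seg xs i l) •
          (prodPow xs (Function.update n i (n i - 1)) i j • ⊤) from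
    desc (xs.length - l) l (by omega) hil hl
  intro c
  induction c with
  | zero =>
    -- `l = d + 1` (`1`-based): nothing to prove
    intro l hlc hil hl
    obtain rfl : l = xs.length := le_antisymm hl (by omega)
    rw [seg_length]
    refine inf_le_right.trans (sup_le le_sup_left (le_sup_right.trans' ?_))
    rw [← Submodule.mul_smul, ← prodPow_eq_mul_update hiIcc (hn i hiIcc)]
  | succ c ihc =>
    intro l hlc hil hl
    rcases hl.eq_or_lt with rfl | hl
    · exact ihc xs.length (by omega) hil le_rfl
    rcases hil.eq_or_lt with rfl | hil'
    · -- `l = i`: `(y)M : xᵢ ∩ [(y)M + q^nM] ⊆ (y)M` by Lemma 2.2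
      intro a ha
      obtain ⟨ha1, ha2⟩ := Submodule.mem_inf.mp ha
      rw [seg_self, List.append_nil, mem_colonBy, getD_eq_getElem hi] at ha1
      rw [seg_self]
      refine Submodule.mem_sup_left ?_
      have := hx.mem_sup_seg_of_smul_mem hys hym le_rfl hi
        (mem_sup_of_le_right (Submodule.smul_mono_left (prodPow_le_tailIdeal hiIcc (hn _ hiIcc)))
          ha2) (by rwa [seg_self, List.append_nil])
      rwa [seg_self, List.append_nil] at this
    -- `i < l < d`: the inductive step
    intro a ha
    obtain ⟨ha1, ha2⟩ := Submodule.mem_inf.mp ha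
    rw [mem_colonBy, getD_eq_getElem hl] at ha1
    -- `a ∈ (y, xᵢ,…,x_l)M : x_{l+1} ∩ […]`, hence in the right-hand side at `l + 1`
    have hnext : a ∈ colonBy (ofList (ys ++ seg xs i (l + 1)) • ⊤ : Submodule R M)
        (xs.getD (l + 1) 1) ⊓ (ofList ys • ⊤ ⊔ prodPow xs n i j • ⊤) := by
      refine Submodule.mem_inf.mpr ⟨?_, ha2⟩
      rw [mem_colonBy]
      rcases (Nat.succ_le_of_lt hl).eq_or_lt with hl1 | hl1
      · -- `l + 1 = d`: `x_{d+1} = 1`, and `a ∈ (y)M + q^nM ⊆ (y, xᵢ,…,x_d)M`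
        have hl1' : l + 1 = xs.length := hl1
        rw [hl1', getD_length, one_smul, seg_length, ofList_append_smul]
        exact mem_sup_of_le_right (Submodule.smul_mono_left (prodPow_le_tailIdeal hiIcc
          (hn i hiIcc))) ha2
      · rw [getD_eq_getElem hl1, seg_succ hil hl, ← List.append_assoc, ofList_append_smul]
        refine Submodule.mem_sup_left ?_
        have e := hx.colonBy_seg_mul_eq hys hym hil (Nat.le_succ l) hl1
        have : a ∈ colonBy (ofList (ys ++ seg xs i l) • ⊤ : Submodule R M) (xs[l] * xs[l + 1]) := by
          rw [mem_colonBy, mul_comm, mul_smul]; exact Submodule.smul_mem _ _ ha1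
        rwa [e, mem_colonBy] at this
    have ha3 := ihc (l + 1) (by omega) (by omega) (by omega) hnext
    rw [seg_succ hil hl, ofList_append_smul, ofList_singleton, ← sup_assoc] at ha3
    -- `a = b + x_l a'` with `a' ∈ q^{n'}M`
    obtain ⟨b, hb, t, ht, e2⟩ := Submodule.mem_sup.mp ha3
    obtain ⟨a', ha', rfl⟩ := mem_span_singleton_smul_iff.mp ht
    -- `a' ∈ (y, xᵢ,…,x_{l-1})M : x_l² = … : x_l`
    have hbP : b ∈ (ofList (ys ++ seg xs i l) • ⊤ : Submodule R M) := by
      rw [ofList_append_smul]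
      exact mem_sup_of_le_right (Submodule.smul_mono le_rfl le_top) hb
    have ha'1 : a' ∈ colonBy (ofList (ys ++ seg xs i l) • ⊤ : Submodule R M) xs[l] := by
      rw [← hx.colonBy_seg_mul_eq hys hym hil le_rfl hl, mem_colonBy, mul_smul]
      have e : xs[l] • (xs[l] • a') = xs[l] • a - xs[l] • b := by rw [← e2, smul_add]; abel
      rw [e]
      exact Submodule.sub_mem _ ha1 (Submodule.smul_mem _ _ hbP)
    -- conclude `a = b + x_l a' ∈ (y)M + (xᵢ,…,x_{l-1})q^{n'}M`
    rw [← e2]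
    exact Submodule.add_mem _ hb (place l hil' hl a' ha'1 ha')

/-- **(3.1.1) in the case `k = i`** (Kawasaki 2000, proof of Thm. 3.1, Step 5: "In the case of
`k = i`, we work by induction on `l` and `nᵢ`"), given `(A_{i+1,j})`, `(C_{i+1,j})`, `i < j`:
for every subsystem of parameters `y` of `M/qᵢM` and `i ≤ l ≤ d + 1`,
`(y, xᵢ,…,x_{l-1})M : x_l ∩ [(y)M + q^{n}M] = (y)M + (xᵢ,…,x_{l-1})qᵢ^{nᵢ-1}q_{i+1}^{n_{i+1}}⋯qⱼ^{nⱼ}M`.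
Induction on `nᵢ` over `kawasakiA31_left_desc`: the element `x_la'` with
`a' ∈ (y,xᵢ,…,x_{l-1})M : x_l ∩ q^{n'}M` is placed by (3.1.6) if `nᵢ = 1` and by the
statement for `nᵢ - 1` otherwise ("Since `x_l ∈ q_{i+1} ⊆ qᵢ`, `a = x_la' + b` is in the right
hand side"). [cite: Kawasaki2000, Thm. 3.1, Step 5] -/
theorem kawasakiA31_left (hx : IsPStandard M xs) {i j : ℕ} (hij : i + 1 ≤ j) (hj : j < xs.length)
    (hA : Kawasaki.A31 M xs (i + 1) j) (hC : Kawasaki.C31 M xs (i + 1) j)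
    {n : ℕ → ℕ} (hn : Kawasaki.PosOn n i j) {ys : List R}
    (hys : IsSecantSequence M (xs.drop i ++ ys)) (hym : ∀ y ∈ ys, y ∈ maximalIdeal R)
    {l : ℕ} (hil : i ≤ l) (hl : l ≤ xs.length) :
    colonBy (ofList (ys ++ seg xs i l) • ⊤ : Submodule R M) (xs.getD l 1) ⊓
        (ofList ys • ⊤ ⊔ prodPow xs n i j • ⊤) =
      ofList ys • ⊤ ⊔ ofList (seg xs i l) • (prodPow xs (Function.update n i (n i - 1)) i j • ⊤) := by
  classical
  have hiIcc : i ∈ Finset.Icc i j := Finset.mem_Icc.mpr ⟨le_rfl, by omega⟩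
  have hi1Icc : i + 1 ∈ Finset.Icc (i + 1) j := Finset.mem_Icc.mpr ⟨le_rfl, hij⟩
  -- induction on `e = nᵢ - 1`, for all positive `n` with `n i = e + 1` and all `l`
  suffices key : ∀ (e : ℕ) (n : ℕ → ℕ), Kawasaki.PosOn n i j → n i = e + 1 →
      ∀ l, i ≤ l → l ≤ xs.length →
        colonBy (ofList (ys ++ seg xs i l) • ⊤ : Submodule R M) (xs.getD l 1) ⊓
            (ofList ys • ⊤ ⊔ prodPow xs n i j • ⊤) ≤
          ofList ys • ⊤ ⊔ ofList (seg xs i l) •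
            (prodPow xs (Function.update n i (n i - 1)) i j • ⊤) by
    refine le_antisymm (key (n i - 1) n hn (by have := hn i hiIcc; omega) l hil hl) ?_
    -- "The opposite inclusion is obvious"
    refine sup_le (le_inf ((Submodule.smul_mono_left (ofList_mono_of_subset fun r hr =>
      List.mem_append_left _ hr)).trans (le_colonBy _ _)) le_sup_left) (le_inf ?_ ?_)
    · refine (Submodule.smul_mono (ofList_mono_of_subset fun r hr => List.mem_append_right _ hr)
        le_top).trans (le_colonBy _ _)
    · exact le_sup_right.trans' (smul_prodPow_update_smul_le (ofList_seg_le_tailIdeal xs i l)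
        hiIcc (hn i hiIcc) ⊤)
  intro e
  induction e with
  | zero =>
    intro n hn hne l hil hl
    refine hx.kawasakiA31_left_desc hij hj hn hys hym (fun l hil' hl a' ha'1 ha' => ?_) hil hl
    -- `nᵢ = 1`: `q^{n'} = q_{i+1}^{n_{i+1}}⋯qⱼ^{nⱼ}`; place `a'` by (3.1.6)
    have hQ : prodPow xs (Function.update n i (n i - 1)) i j = prodPow xs n (i + 1) j := by
      rw [prodPow_eq_mul _ (by omega : i ≤ j), Function.update_self, hne, Nat.zero_add,
        Nat.sub_self, pow_zero, one_mul]
      exact prodPow_congr fun t ht => Function.update_of_ne (by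
        rw [Finset.mem_Icc] at ht; omega) _ _
    rw [hQ] at ha' ⊢
    have h316 := hx.kawasaki316 hij hj hA hC (hn.mono (Nat.le_succ i) le_rfl) hys hym hil'.le hl.le
    have ha'2 := h316 (Submodule.mem_inf.mpr
      ⟨by rwa [getD_eq_getElem hl], Submodule.mem_sup_right ha'⟩)
    have hxl' : xs[l] ∈ tailIdeal xs (i + 1) := getElem_mem_tailIdeal hil' hl
    have hle : span {xs[l]} • (ofList ys • ⊤ ⊔ ofList (seg xs i l) •
        (prodPow xs (Function.update n (i + 1) (n (i + 1) - 1)) (i + 1) j • (⊤ : Submodule R M))) ≤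
          ofList ys • ⊤ ⊔ ofList (seg xs i l) • (prodPow xs n (i + 1) j • ⊤) := by
      rw [Submodule.smul_sup]
      refine sup_le_sup Submodule.smul_le_right ?_
      rw [← Submodule.mul_smul, mul_comm, Submodule.mul_smul]
      exact Submodule.smul_mono le_rfl (smul_prodPow_update_smul_le
        ((Ideal.span_singleton_le_iff_mem _).mpr hxl') hi1Icc (hn _ (Finset.mem_Icc.mpr
          ⟨Nat.le_succ i, hij⟩)) ⊤)
    exact hle (mem_span_singleton_smul_iff.mpr ⟨a', ha'2, rfl⟩)
  | succ e ihe =>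
    intro n hn hne l hil hl
    refine hx.kawasakiA31_left_desc hij hj hn hys hym (fun l hil' hl a' ha'1 ha' => ?_) hil hl
    -- `nᵢ > 1`: place `a'` by the statement for `nᵢ - 1`
    have hn' : Kawasaki.PosOn (Function.update n i (n i - 1)) i j := hn.update (by omega)
    have ha'2 := ihe (Function.update n i (n i - 1)) hn'
      (by rw [Function.update_self]; omega) l hil'.le hl.le
      (Submodule.mem_inf.mpr ⟨by rwa [getD_eq_getElem hl], Submodule.mem_sup_right ha'⟩)
    have hxl : xs[l] ∈ tailIdeal xs i := getElem_mem_tailIdeal hil'.le hl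
    have hle : span {xs[l]} • (ofList ys • ⊤ ⊔ ofList (seg xs i l) •
        (prodPow xs (Function.update (Function.update n i (n i - 1)) i
          (Function.update n i (n i - 1) i - 1)) i j • (⊤ : Submodule R M))) ≤
          ofList ys • ⊤ ⊔ ofList (seg xs i l) •
            (prodPow xs (Function.update n i (n i - 1)) i j • ⊤) := by
      rw [Submodule.smul_sup]
      refine sup_le_sup Submodule.smul_le_right ?_
      rw [← Submodule.mul_smul, mul_comm, Submodule.mul_smul]
      exact Submodule.smul_mono le_rfl (smul_prodPow_update_smul_le
        ((Ideal.span_singleton_le_iff_mem _).mpr hxl) hiIcc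
        (by rw [Function.update_self]; omega) ⊤)
    exact hle (mem_span_singleton_smul_iff.mpr ⟨a', ha'2, rfl⟩)

end IsPStandard

end Literature.AlgebraicGeometry.Resolution
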